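/-
Copyright: derived here (Resolution Observatory cell `pub-rosobs`, carver gen 52; v2 = v1 (p379573) + scalar form of T26 (c) + Wilson). AI-written Lean; AI review is
weaker than expert review.  Companion file of the cell's POLYNOMIAL weighted-centre model `W(f)`: the abstract core of engine 1's
LEMMA S / LEMMA C ("truncated exponential of a derivation vs. carries"; THEOREM-FS-eng1-g35 §1; CARVER-NOTES-eng1-g35 T23, T26 (c)).
Instrument — NOT a resolution theorem and NOT a statement about the invariant of [AbramovichTemkinWlodarczyk2024].
-/
import Mathlib.RingTheory.Derivation.Basic
import Mathlib.Algebra.MvPolynomial.CommRing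
import Mathlib.Algebra.Polynomial.BigOperators
import Mathlib.Algebra.BigOperators.NatAntidiagonal
import Mathlib.Data.Fintype.BigOperators
import Mathlib.Data.Nat.Choose.Sum
import Mathlib.NumberTheory.Wilson
import Mathlib.Tactic.LinearCombination
import Mathlib.Tactic.Ring
import Mathlib.Tactic.Abel
import HarnessLib

/-!
# Truncated exponential of a derivation vs. carries

Setting: `R` a commutative ring, `A = MvPolynomial ι R`, `D : Derivation R A A` (no nilpotency, no characteristic hypothesis), a
cut-off `p : ℕ` and a sequence `u : ℕ → R` of INVERSE FACTORIALS BELOW `p`, `k ! * u k = 1` for `k < p` (e.g. `u k = 1/k!` in a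
`ℚ`-algebra, `(k!)⁻¹ ∈ 𝔽_p ⊆ R` in characteristic `p`, or `factorialInvSeq` from `Invertible ((p-1)! : R)`).  The `R`-algebra hom
`T = sigmaExp D p u : A →ₐ[R] A[σ]` (the cell's `T_σ`; `truncExp` is taken by the constant-field file's `E_N`) is defined on
generators by the `σ`-TRUNCATED EXPONENTIAL
`T (X i) = Σ_{k<p} u_k · D^[k](X i) · σ^k`, and `carry D p u n g := coeff σ^n (T g)` (`R_n g` in the cell's notes).

* `coeff_sigmaExp_of_lt` (**S2**): for EVERY `g` and `n < p`, `coeff σ^n (T g) = u_n · D^[n] g` — below `σ^p` the hom `T` IS the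
  truncated exponential `Σ_{k<p} u_k σ^k D^k` (the sequence `(u_k D^k)_{k<p}` is a higher derivation of length `p − 1`, i.e.
  `g ↦ Σ_{k<p} u_k D^k g σ^k` is multiplicative modulo `σ^p`: multinomial Leibniz, every composition of `n < p` has parts `< p`);
* `coeff_sigmaExp_prod_X` (**S1**, "positions formula"): for a monomial word `m = Π_{l : Fin d} X (f l)` and every `n`,
  `coeff σ^n (T m) = Σ_{k : Fin d → [0,p), Σ k = n} Π_l u_{k l} · D^[k l](X (f l))` — for `n ≥ p` these are the CARRIES;
* `sigmaExp_coeff_zero_of_apply_eq_zero`, `sigmaExp_coeff_eq_zero_of_apply_eq_zero` (**S3**): `D g = 0 ⇒ coeff σ^0 (T g) = g` and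
  `coeff σ^n (T g) = 0` for `1 ≤ n < p`; hence `sigmaExp_eq_C_iff` : `T g = g ⟺ all carries `R_n g`, `n ≥ p`, vanish` (the dichotomy
  LEMMA S runs on: `T` is an isotropy of `g` iff the carries vanish);
* `sigmaExp_coeff_eq_zero_of_order` (**LEMMA C core**): if `D^[o i + 1](X i) = 0` ("`X i` has order `≤ o i`") for the variables of
  `g` and every monomial `X^e` of `g` has total order `Σ_i e_i · o_i < n`, then `coeff σ^n (T g) = 0`;
* `coeff_prod_quadratic_top_sub_one`, `sigmaExp_coeff_two_mul_sub_one(')` (**T26 (c)**): if every variable has order `≤ 2` then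
  `R_{2d−1}(Π_{l<d} X (f l)) = u_1 u_2^{d−1} Σ_l D(X (f l)) · Π_{l' ≠ l} D^[2](X (f l'))`;
* `invertibleFactorialPred` : in prime characteristic `p`, `(p−1)!` is invertible (Wilson), so `factorialInvSeq p` discharges the
  inverse-factorial hypothesis canonically.

What is NOT here: any grading / weights, the iterative exponential `E_k` repairing the carries, and the systems `(N, g)` of the cell —
those are engine 1's THEOREM-FS.  Classical background: higher derivations / truncated exponentials `E_t : A → A[t]/(t^{m+1})`
[Matsumura1987, §27 (pp. 207–209)]; [ATW24] = Abramovich–Temkin–Włodarczyk, Algebra & Number Theory 18 (2024), §5.1 — CONTEXT ONLY;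
the packaging is ours.
-/

namespace Literature.AlgebraicGeometry.Resolution.WeightedBlowup

open MvPolynomial Finset
open scoped Nat Polynomial

section Leibniz

variable {R A : Type*} [CommSemiring R] [CommRing A] [Algebra R A] (D : Derivation R A A)

/-- Iterates of a derivation are additive (derived here). [cite: Matsumura1987, §25 (derivations)] -/
theorem derivation_iterate_map_add (n : ℕ) : ∀ a b : A, D^[n] (a + b) = D^[n] a + D^[n] b := by
  induction n with
  | zero => intro a b; rfl
  | succ n ih =>
    intro a b
    rw [Function.iterate_succ_apply, Function.iterate_succ_apply, Function.iterate_succ_apply, map_add, ih]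

/-- Iterates of a derivation commute with scalars (derived here). [cite: Matsumura1987, §25 (derivations)] -/
theorem derivation_iterate_map_smul (n : ℕ) (r : R) : ∀ a : A, D^[n] (r • a) = r • D^[n] a := by
  induction n with
  | zero => intro a; rfl
  | succ n ih =>
    intro a
    rw [Function.iterate_succ_apply, Function.iterate_succ_apply, D.map_smul, ih]

/-- `D^[n+1]` kills the scalars (derived here). [cite: Matsumura1987, §25 (derivations)] -/
theorem derivation_iterate_succ_algebraMap (n : ℕ) (r : R) : D^[n + 1] (algebraMap R A r) = 0 := by
  rw [Function.iterate_succ_apply, Derivation.map_algebraMap, Function.iterate_fixed (map_zero D)]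

/-- Past a vanishing iterate all iterates vanish: `D^[m] a = 0`, `m ≤ k` ⇒ `D^[k] a = 0` (derived here).
[cite: Matsumura1987, §25 (derivations)] -/
theorem derivation_iterate_eq_zero_of_le {m k : ℕ} {a : A} (h : D^[m] a = 0) (hk : m ≤ k) : D^[k] a = 0 := by
  obtain ⟨j, rfl⟩ := Nat.exists_eq_add_of_le hk
  rw [add_comm, Function.iterate_add_apply, h, Function.iterate_fixed (map_zero D)]

/-- **Leibniz rule for iterates of a derivation** (antidiagonal form): `Dⁿ(a b) = Σ_{i+j=n} C(n,i) Dⁱ(a) Dʲ(b)` (derived here; the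
same statement is proved in other tree files, re-proved to keep this file Mathlib-only). [cite: Matsumura1987, §25 (derivations)] -/
theorem derivation_iterate_mul (a b : A) : ∀ n : ℕ,
    D^[n] (a * b) = ∑ x ∈ antidiagonal n, n.choose x.1 • (D^[x.1] a * D^[x.2] b) := by
  intro n
  induction n with
  | zero => simp
  | succ n ih =>
    have h1 : ∑ q ∈ antidiagonal (n + 1), n.choose q.1 • (D^[q.1] a * D^[q.2] b) =
        ∑ x ∈ antidiagonal n, n.choose x.1 • (D^[x.1] a * D^[x.2 + 1] b) := by
      rw [Finset.Nat.sum_antidiagonal_succ']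
      simp
    have h2 : ∑ q ∈ antidiagonal (n + 1), n.choose q.1 • (D^[q.1] a * D^[q.2] b) =
        a * D^[n + 1] b + ∑ x ∈ antidiagonal n, n.choose (x.1 + 1) • (D^[x.1 + 1] a * D^[x.2] b) := by
      rw [Finset.Nat.sum_antidiagonal_succ]
      simp
    have h4 : ∀ x : ℕ × ℕ, D (n.choose x.1 • (D^[x.1] a * D^[x.2] b)) =
        n.choose x.1 • (D^[x.1 + 1] a * D^[x.2] b) + n.choose x.1 • (D^[x.1] a * D^[x.2 + 1] b) := by
      intro x
      rw [map_nsmul, Derivation.leibniz, smul_eq_mul, smul_eq_mul, Function.iterate_succ_apply',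
        Function.iterate_succ_apply', ← smul_add]
      congr 1
      ring
    calc D^[n + 1] (a * b)
        = D (∑ x ∈ antidiagonal n, n.choose x.1 • (D^[x.1] a * D^[x.2] b)) := by
          rw [Function.iterate_succ_apply', ih]
      _ = ∑ x ∈ antidiagonal n, n.choose x.1 • (D^[x.1 + 1] a * D^[x.2] b) +
            ∑ x ∈ antidiagonal n, n.choose x.1 • (D^[x.1] a * D^[x.2 + 1] b) := by
          rw [map_sum]
          simp_rw [h4]
          rw [Finset.sum_add_distrib]
      _ = ∑ x ∈ antidiagonal n, n.choose x.1 • (D^[x.1 + 1] a * D^[x.2] b) +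
            (a * D^[n + 1] b + ∑ x ∈ antidiagonal n, n.choose (x.1 + 1) • (D^[x.1 + 1] a * D^[x.2] b)) := by
          rw [h1.symm.trans h2]
      _ = a * D^[n + 1] b +
            ∑ x ∈ antidiagonal n, (n.choose x.1 + n.choose (x.1 + 1)) • (D^[x.1 + 1] a * D^[x.2] b) := by
          simp_rw [add_smul, Finset.sum_add_distrib]
          abel
      _ = ∑ q ∈ antidiagonal (n + 1), (n + 1).choose q.1 • (D^[q.1] a * D^[q.2] b) := by
          rw [Finset.Nat.sum_antidiagonal_succ]
          simp only [Nat.choose_zero_right, one_smul, Function.iterate_zero, id_eq, Nat.choose_succ_succ']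

end Leibniz

section InverseFactorials

variable {R : Type*} [CommRing R]

/-- The binomial identity behind "every composition of `n < p` has parts `< p`": if `u_a a! = u_b b! = u_{a+b} (a+b)! = 1` then
`u_{a+b} · C(a+b, a) = u_a · u_b` (derived here). [cite: Matsumura1987, §27 (pp. 207–209)] -/
theorem inv_factorial_mul_choose {u : ℕ → R} {a b : ℕ} (ha : (a ! : R) * u a = 1) (hb : (b ! : R) * u b = 1)
    (hab : ((a + b)! : R) * u (a + b) = 1) : u (a + b) * ((a + b).choose a : ℕ) = u a * u b := by
  have h4 := congrArg (Nat.cast : ℕ → R) (Nat.add_choose_mul_factorial_mul_factorial a b)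
  rw [← Nat.choose_symm_add] at h4
  push_cast at h4
  have hab2 : (a ! : R) * u a * ((b ! : R) * u b) = 1 := by rw [ha, hb, one_mul]
  linear_combination (-(u (a + b) * (((a + b).choose a : ℕ) : R))) * hab2
    + (u a * u b * u (a + b)) * h4 + (u a * u b) * hab

/-- A canonical inverse-factorial sequence below `p` from `Invertible ((p-1)! : R)`: `u k = ⅟(p-1)! · ((p-1)!/k!)` (derived here).
[cite: Matsumura1987, §27 (pp. 207–209)] -/
noncomputable def factorialInvSeq (p : ℕ) [Invertible ((p - 1)! : R)] : ℕ → R :=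
  fun k => ⅟((p - 1)! : R) * (((p - 1)! / k ! : ℕ) : R)

/-- `k! · factorialInvSeq p k = 1` for `k < p` (derived here). [cite: Matsumura1987, §27 (pp. 207–209)] -/
theorem factorial_mul_factorialInvSeq (p : ℕ) [Invertible ((p - 1)! : R)] {k : ℕ} (hk : k < p) :
    (k ! : R) * factorialInvSeq p k = 1 := by
  have hdvd : k ! ∣ (p - 1)! := Nat.factorial_dvd_factorial (by omega)
  have hnat : k ! * ((p - 1)! / k !) = (p - 1)! := Nat.mul_div_cancel' hdvd
  unfold factorialInvSeq
  calc (k ! : R) * (⅟((p - 1)! : R) * (((p - 1)! / k ! : ℕ) : R))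
      = ⅟((p - 1)! : R) * ((k ! * ((p - 1)! / k !) : ℕ) : R) := by push_cast; ring
    _ = 1 := by rw [hnat, invOf_mul_self]

end InverseFactorials

section TruncExp

variable {R : Type*} [CommRing R] {ι : Type*} (D : Derivation R (MvPolynomial ι R) (MvPolynomial ι R)) (p : ℕ) (u : ℕ → R)

/-- The `σ`-truncated exponential of `D` on generators, extended to an `R`-algebra hom `T : A →ₐ[R] A[σ]`
(`A = MvPolynomial ι R`, `σ = Polynomial.X`): `T (X i) = Σ_{k<p} u_k · D^[k](X i) · σ^k` (derived here; the cell's `T_σ`).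
[cite: Matsumura1987, §27 (pp. 207–209)] -/
noncomputable def sigmaExp : MvPolynomial ι R →ₐ[R] (MvPolynomial ι R)[X] :=
  MvPolynomial.aeval fun i => ∑ k ∈ range p, Polynomial.C (u k • D^[k] (X i)) * Polynomial.X ^ k

/-- The `n`-th `σ`-coefficient of `T g` as an `R`-linear map in `g` (the cell's `R_n`; a CARRY when `n ≥ p`) (derived here).
[cite: Matsumura1987, §27 (pp. 207–209)] -/
noncomputable def carry (n : ℕ) : MvPolynomial ι R →ₗ[R] MvPolynomial ι R :=
  ((Polynomial.lcoeff (MvPolynomial ι R) n).restrictScalars R).comp (sigmaExp D p u).toLinearMap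

/-- `R_n g = coeff σ^n (T g)` (derived here; definitional). [cite: Matsumura1987, §27 (pp. 207–209)] -/
@[simp] theorem carry_apply (n : ℕ) (g : MvPolynomial ι R) : carry D p u n g = (sigmaExp D p u g).coeff n := rfl

/-- `T` on a generator is the truncated exponential `Σ_{k<p} u_k D^[k](X i) σ^k` (derived here; by definition).
[cite: Matsumura1987, §27 (pp. 207–209)] -/
theorem sigmaExp_X (i : ι) :
    sigmaExp D p u (X i) = ∑ k ∈ range p, Polynomial.C (u k • D^[k] (X i)) * Polynomial.X ^ k := by
  simp [sigmaExp]

/-- `coeff σ^n (T (X i)) = u_n D^[n](X i)` for `n < p`, `0` otherwise (derived here). [cite: Matsumura1987, §27 (pp. 207–209)] -/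
theorem coeff_sigmaExp_X (i : ι) (n : ℕ) :
    (sigmaExp D p u (X i)).coeff n = if n < p then u n • D^[n] (X i) else 0 := by
  rw [sigmaExp_X, Polynomial.finsetSum_coeff]
  simp_rw [Polynomial.coeff_C_mul_X_pow]
  rw [Finset.sum_ite_eq (range p) n]
  split_ifs <;> simp_all [mem_range]

/-- `T` fixes the scalars: `T (C r) = C r · σ^0` (derived here). [cite: Matsumura1987, §27 (pp. 207–209)] -/
theorem sigmaExp_C (r : R) : sigmaExp D p u (C r) = Polynomial.C (C r) := by
  rw [sigmaExp, MvPolynomial.algHom_C]; rfl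

/-- `T` on a monomial `r · X^e` is `C r · Π_i T(X i)^{e i}` (derived here; `T` is a ring hom). [cite: Matsumura1987, §27 (pp. 207–209)] -/
theorem sigmaExp_monomial (e : ι →₀ ℕ) (r : R) :
    sigmaExp D p u (monomial e r) = Polynomial.C (C r) * e.prod fun i k => sigmaExp D p u (X i) ^ k := by
  rw [MvPolynomial.monomial_eq, map_mul, sigmaExp_C, Finsupp.prod, map_prod, Finsupp.prod]
  simp_rw [map_pow]

/-- **(S2) Below `σ^p`, `T` is the truncated exponential**: for every `g` and `n < p`, `coeff σ^n (T g) = u_n · D^[n] g`, provided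
`k! u_k = 1` for `k < p` (derived here: induction on `g`; the multiplicative step is the Leibniz rule plus
`u_{a+b} C(a+b,a) = u_a u_b` for `a + b < p`). [cite: Matsumura1987, §27 (pp. 207–209)] -/
theorem coeff_sigmaExp_of_lt (hu : ∀ k < p, (k ! : R) * u k = 1) (g : MvPolynomial ι R) {n : ℕ} (hn : n < p) :
    (sigmaExp D p u g).coeff n = u n • D^[n] g := by
  induction g using MvPolynomial.induction_on generalizing n with
  | C r =>
    rw [sigmaExp_C, Polynomial.coeff_C]
    rcases n with _ | n
    · have h0 : u 0 = 1 := by simpa using hu 0 hn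
      simp [h0]
    · rw [if_neg (Nat.succ_ne_zero n), ← MvPolynomial.algebraMap_eq, derivation_iterate_succ_algebraMap, smul_zero]
  | add a b ha hb => rw [map_add, Polynomial.coeff_add, ha hn, hb hn, derivation_iterate_map_add, smul_add]
  | mul_X g i hg =>
    rw [map_mul, Polynomial.coeff_mul, derivation_iterate_mul, Finset.smul_sum]
    refine Finset.sum_congr rfl fun x hx => ?_
    have hx' : x.1 + x.2 = n := mem_antidiagonal.mp hx
    have h1 : x.1 < p := by omega
    have h2 : x.2 < p := by omega
    rw [hg h1, coeff_sigmaExp_X, if_pos h2, smul_mul_smul_comm, ← Nat.cast_smul_eq_nsmul R, smul_smul, ← hx',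
      inv_factorial_mul_choose (hu _ h1) (hu _ h2) (hu _ (by omega))]

/-- (S2) for the linear maps: `R_n = u_n · D^n` for `n < p` (derived here). [cite: Matsumura1987, §27 (pp. 207–209)] -/
theorem carry_eq_of_lt (hu : ∀ k < p, (k ! : R) * u k = 1) {n : ℕ} (hn : n < p) (g : MvPolynomial ι R) :
    carry D p u n g = u n • D^[n] g :=
  coeff_sigmaExp_of_lt D p u hu g hn

/-- **(S3)** `D g = 0 ⇒ coeff σ^0 (T g) = g` (needs `1 ≤ p`) (derived here). [cite: Matsumura1987, §27 (pp. 207–209)] -/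
theorem sigmaExp_coeff_zero (hu : ∀ k < p, (k ! : R) * u k = 1) (hp : 1 ≤ p) (g : MvPolynomial ι R) :
    (sigmaExp D p u g).coeff 0 = g := by
  have h0 : u 0 = 1 := by simpa using hu 0 hp
  rw [coeff_sigmaExp_of_lt D p u hu g hp, h0, one_smul, Function.iterate_zero, id]

/-- **(S3)** `D g = 0 ⇒ coeff σ^n (T g) = 0` for `1 ≤ n < p`: below `σ^p` a `D`-constant is a `T`-constant; only CARRIES (`n ≥ p`)
can remain (derived here). [cite: Matsumura1987, §27 (pp. 207–209)] -/
theorem sigmaExp_coeff_eq_zero_of_apply_eq_zero (hu : ∀ k < p, (k ! : R) * u k = 1) {g : MvPolynomial ι R} (hg : D g = 0)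
    {n : ℕ} (h1 : 1 ≤ n) (hn : n < p) : (sigmaExp D p u g).coeff n = 0 := by
  rw [coeff_sigmaExp_of_lt D p u hu g hn, derivation_iterate_eq_zero_of_le D (m := 1) (by simpa using hg) h1, smul_zero]

/-- **The dichotomy LEMMA S runs on** (derived here): for a `D`-constant `g` (and `1 ≤ p`), `T g = g` (i.e. `T` is an isotropy of `g`)
iff ALL CARRIES `R_n g`, `n ≥ p`, vanish. [cite: AbramovichTemkinWlodarczyk2024, §5.1 (p. 1575)] -/
theorem sigmaExp_eq_C_iff (hu : ∀ k < p, (k ! : R) * u k = 1) (hp : 1 ≤ p) {g : MvPolynomial ι R} (hg : D g = 0) :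
    sigmaExp D p u g = Polynomial.C g ↔ ∀ n, p ≤ n → (sigmaExp D p u g).coeff n = 0 := by
  constructor
  · intro h n hpn
    rw [h, Polynomial.coeff_C, if_neg (by omega)]
  · intro h
    refine Polynomial.ext fun n => ?_
    rw [Polynomial.coeff_C]
    split_ifs with h0
    · subst h0; exact sigmaExp_coeff_zero D p u hu hp g
    · rcases Nat.lt_or_ge n p with hnp | hpn
      · exact sigmaExp_coeff_eq_zero_of_apply_eq_zero D p u hu hg (by omega) hnp
      · exact h n hpn

/-- **(S1) Positions formula** (derived here): for a monomial word `m = Π_{l<d} X (f l)` and every `n`,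
`coeff σ^n (T m) = Σ_{k : Fin d → [0,p), Σ_l k l = n} Π_l u_{k l} · D^[k l](X (f l))` — the cell's `R_n(m)`; for `n ≥ p` the carries.
[cite: Matsumura1987, §27 (pp. 207–209)] -/
theorem coeff_sigmaExp_prod_X {d : ℕ} (f : Fin d → ι) (n : ℕ) :
    (sigmaExp D p u (∏ l, X (f l))).coeff n =
      ∑ k ∈ (Fintype.piFinset fun _ : Fin d => range p) with ∑ l, k l = n, ∏ l, u (k l) • D^[k l] (X (f l)) := by
  rw [map_prod]
  simp_rw [sigmaExp_X]
  rw [Finset.prod_univ_sum, Polynomial.finsetSum_coeff, Finset.sum_filter]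
  refine Finset.sum_congr rfl fun k _ => ?_
  rw [Finset.prod_mul_distrib, ← map_prod Polynomial.C, Finset.prod_pow_eq_pow_sum, Polynomial.coeff_C_mul_X_pow]
  simp only [eq_comm]

variable {D p u} in
/-- `T (X i)` has `σ`-degree at most the ORDER of `X i`: `D^[o+1](X i) = 0 ⇒ natDegree (T (X i)) ≤ o` (derived here).
[cite: Matsumura1987, §27 (pp. 207–209)] -/
theorem natDegree_sigmaExp_X_le {i : ι} {o : ℕ} (ho : D^[o + 1] (X i) = 0) : (sigmaExp D p u (X i)).natDegree ≤ o := by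
  rw [Polynomial.natDegree_le_iff_coeff_eq_zero]
  intro N hN
  rw [coeff_sigmaExp_X]
  split_ifs
  · rw [derivation_iterate_eq_zero_of_le D ho (by exact_mod_cast hN), smul_zero]
  · rfl

variable {D p u} in
/-- **LEMMA C core, monomial form** (derived here): if `D^[o i + 1](X i) = 0` for the variables of the exponent `e` and the TOTAL ORDER
`Σ_i e_i · o_i < n`, then `coeff σ^n (T (r · X^e)) = 0` — each term of the positions formula has some part `k_l > o(f_l)`; here: a
degree count. [cite: AbramovichTemkinWlodarczyk2024, §5.1 (p. 1575)] -/
theorem sigmaExp_monomial_coeff_eq_zero_of_order (o : ι → ℕ) (e : ι →₀ ℕ) (r : R) (ho : ∀ i ∈ e.support, D^[o i + 1] (X i) = 0)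
    {n : ℕ} (hn : e.sum (fun i k => k * o i) < n) : (sigmaExp D p u (monomial e r)).coeff n = 0 := by
  apply Polynomial.coeff_eq_zero_of_natDegree_lt
  refine lt_of_le_of_lt ?_ hn
  rw [sigmaExp_monomial, Finsupp.prod]
  refine (Polynomial.natDegree_C_mul_le _ _).trans ?_
  refine (Polynomial.natDegree_prod_le _ _).trans ?_
  rw [Finsupp.sum]
  refine Finset.sum_le_sum fun i hi => ?_
  refine Polynomial.natDegree_pow_le.trans ?_
  exact Nat.mul_le_mul_left _ (natDegree_sigmaExp_X_le (ho i hi))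

variable {D p u} in
/-- **LEMMA C core** (derived here): if every variable `X i` occurring in `g` has order `≤ o i` (`D^[o i + 1](X i) = 0`) and every
monomial `X^e` of `g` has total order `Σ_i e_i · o_i < n`, then `R_n g = coeff σ^n (T g) = 0`.  With `n ≥ p`: "no monomial of total
order `≥ p` ⇒ all carries vanish". [cite: AbramovichTemkinWlodarczyk2024, §5.1 (p. 1575)] -/
theorem sigmaExp_coeff_eq_zero_of_order (o : ι → ℕ) (g : MvPolynomial ι R)
    (ho : ∀ e ∈ g.support, ∀ i ∈ e.support, D^[o i + 1] (X i) = 0) {n : ℕ}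
    (hn : ∀ e ∈ g.support, e.sum (fun i k => k * o i) < n) : (sigmaExp D p u g).coeff n = 0 := by
  conv_lhs => rw [g.as_sum, map_sum, Polynomial.finsetSum_coeff]
  exact Finset.sum_eq_zero fun e he => sigmaExp_monomial_coeff_eq_zero_of_order o e _ (ho e he) (hn e he)

end TruncExp

section QuadraticTop

variable {A : Type*} [CommRing A]

/-- Coefficient bookkeeping (derived here): for a NONEMPTY finite family of quadratics `c_l σ² + b_l σ + a_l`, `l ∈ s`, the
coefficient of `σ^{2|s|−1}` of their product is `Σ_{l ∈ s} b_l · Π_{l' ∈ s, l' ≠ l} c_{l'}` ("all factors at top degree but one").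
[cite: Matsumura1987, §27 (pp. 207–209)] -/
theorem coeff_prod_quadratic_top_sub_one {κ : Type*} [DecidableEq κ] (a b c : κ → A) (s : Finset κ) (hs : s.Nonempty) :
    (∏ l ∈ s, (Polynomial.C (c l) * Polynomial.X ^ 2 + Polynomial.C (b l) * Polynomial.X + Polynomial.C (a l))).coeff
        (2 * s.card - 1) = ∑ l ∈ s, b l * ∏ l' ∈ s.erase l, c l' := by
  induction s using Finset.induction_on with
  | empty => exact absurd hs Finset.not_nonempty_empty
  | insert x s hx ih =>
    rcases s.eq_empty_or_nonempty with rfl | hs'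
    · simp [Polynomial.coeff_C]
    · set Q := ∏ l ∈ s, (Polynomial.C (c l) * Polynomial.X ^ 2 + Polynomial.C (b l) * Polynomial.X + Polynomial.C (a l))
        with hQ
      have hk : 0 < s.card := Finset.card_pos.mpr hs'
      have hQdeg : Q.natDegree ≤ s.card * 2 := by
        refine (Polynomial.natDegree_prod_le _ _).trans ?_
        rw [← smul_eq_mul]
        exact Finset.sum_le_card_nsmul _ _ _ fun l _ => Polynomial.natDegree_quadratic_le
      have hQtop : Q.coeff (s.card * 2) = ∏ l ∈ s, c l := by
        rw [hQ, Polynomial.coeff_prod_of_natDegree_le s _ 2 fun l _ => Polynomial.natDegree_quadratic_le]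
        refine Finset.prod_congr rfl fun l _ => ?_
        simp
      have t1 : (Polynomial.X ^ 2 * Q).coeff (2 * (s.card + 1) - 1) = Q.coeff (2 * s.card - 1) := by
        rw [show 2 * (s.card + 1) - 1 = (2 * s.card - 1) + 2 by omega, Polynomial.coeff_X_pow_mul]
      have t2 : (Polynomial.X * Q).coeff (2 * (s.card + 1) - 1) = Q.coeff (s.card * 2) := by
        rw [show 2 * (s.card + 1) - 1 = s.card * 2 + 1 by omega, Polynomial.coeff_X_mul]
      have t3 : Q.coeff (2 * (s.card + 1) - 1) = 0 :=
        Polynomial.coeff_eq_zero_of_natDegree_lt (lt_of_le_of_lt hQdeg (by omega))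
      have hPQ : (Polynomial.C (c x) * Polynomial.X ^ 2 + Polynomial.C (b x) * Polynomial.X + Polynomial.C (a x)) * Q =
          Polynomial.C (c x) * (Polynomial.X ^ 2 * Q) + Polynomial.C (b x) * (Polynomial.X * Q) +
            Polynomial.C (a x) * Q := by ring
      rw [Finset.prod_insert hx, Finset.card_insert_of_notMem hx, ← hQ, hPQ, Polynomial.coeff_add, Polynomial.coeff_add,
        Polynomial.coeff_C_mul, Polynomial.coeff_C_mul, Polynomial.coeff_C_mul, t1, t2, t3, ih hs', hQtop, mul_zero,
        add_zero, Finset.sum_insert hx, Finset.erase_insert hx, add_comm, Finset.mul_sum]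
      congr 1
      refine Finset.sum_congr rfl fun l hl => ?_
      rw [Finset.erase_insert_of_ne (ne_of_mem_of_not_mem hl hx).symm,
        Finset.prod_insert fun h => hx (Finset.mem_of_mem_erase h)]
      ring

end QuadraticTop

section OrderTwo

variable {R : Type*} [CommRing R] {ι : Type*} (D : Derivation R (MvPolynomial ι R) (MvPolynomial ι R)) (p : ℕ) (u : ℕ → R)

variable {D p} in
/-- For a variable of ORDER `≤ 2` (`D^[3](X i) = 0`) and cut-off `p ≥ 3`, `T (X i)` is the quadratic
`u_2 D^[2](X i) σ² + u_1 D(X i) σ + u_0 X i` (derived here). [cite: Matsumura1987, §27 (pp. 207–209)] -/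
theorem sigmaExp_X_of_order_two {i : ι} (ho : D^[3] (X i) = 0) (hp : 3 ≤ p) :
    sigmaExp D p u (X i) = Polynomial.C (u 2 • D^[2] (X i)) * Polynomial.X ^ 2 + Polynomial.C (u 1 • D (X i)) * Polynomial.X +
      Polynomial.C (u 0 • X i) := by
  refine Polynomial.ext fun n => ?_
  rw [coeff_sigmaExp_X]
  rcases n with _ | _ | _ | n
  · rw [if_pos (by omega)]; simp
  · rw [if_pos (by omega)]; simp
  · rw [if_pos (by omega)]; simp
  · have hz : D^[n + 3] (X i) = 0 := derivation_iterate_eq_zero_of_le D ho (by omega)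
    simp [hz]

/-- **T26 (c): `R_{2d−1}` of a degree-`d` word when every variable has order `≤ 2`** (derived here): for `p ≥ 3`, `d ≥ 1` and
`D^[3](X (f l)) = 0` for all positions `l`,
`coeff σ^{2d−1} (T (Π_l X (f l))) = Σ_l (u_1 D(X (f l))) · Π_{l' ≠ l} (u_2 D^[2](X (f l')))` ( `= u_1 u_2^{d−1} Σ_w D(X w)·(∂_w m)(X ↦ D^[2] X)`;
the cell's `(7, 1/36)` closure uses `d = 4`, `2d − 1 = 7 = p`). [cite: AbramovichTemkinWlodarczyk2024, §5.1 (p. 1575)] -/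
theorem sigmaExp_coeff_two_mul_sub_one (hp : 3 ≤ p) {d : ℕ} (hd : 1 ≤ d) (f : Fin d → ι)
    (ho : ∀ l, D^[3] (X (f l)) = 0) :
    (sigmaExp D p u (∏ l, X (f l))).coeff (2 * d - 1) =
      ∑ l, u 1 • D (X (f l)) * ∏ l' ∈ univ.erase l, u 2 • D^[2] (X (f l')) := by
  haveI : Nonempty (Fin d) := ⟨⟨0, hd⟩⟩
  rw [map_prod, Finset.prod_congr rfl fun l _ => sigmaExp_X_of_order_two u (ho l) hp]
  have h := coeff_prod_quadratic_top_sub_one (fun l => u 0 • X (f l)) (fun l => u 1 • D (X (f l)))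
    (fun l => u 2 • D^[2] (X (f l))) (univ : Finset (Fin d)) Finset.univ_nonempty
  rw [Finset.card_fin] at h
  exact h

end OrderTwo

section Scalars

variable {R : Type*} [CommRing R] {ι : Type*} (D : Derivation R (MvPolynomial ι R) (MvPolynomial ι R)) (p : ℕ) (u : ℕ → R)

/-- **T26 (c), scalars pulled out** (derived here): under the hypotheses of `sigmaExp_coeff_two_mul_sub_one`,
`coeff σ^{2d−1} (T (Π_l X (f l))) = C (u_1 u_2^{d−1}) · Σ_l D(X (f l)) · Π_{l' ≠ l} D^[2](X (f l'))` (with `u_k = 1/k!`, `d = 4`: the factor `1/8`).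
[cite: AbramovichTemkinWlodarczyk2024, §5.1 (p. 1575)] -/
theorem sigmaExp_coeff_two_mul_sub_one' (hp : 3 ≤ p) {d : ℕ} (hd : 1 ≤ d) (f : Fin d → ι)
    (ho : ∀ l, D^[3] (X (f l)) = 0) :
    (sigmaExp D p u (∏ l, X (f l))).coeff (2 * d - 1) =
      C (u 1 * u 2 ^ (d - 1)) * ∑ l, D (X (f l)) * ∏ l' ∈ univ.erase l, D^[2] (X (f l')) := by
  rw [sigmaExp_coeff_two_mul_sub_one D p u hp hd f ho, Finset.mul_sum]
  refine Finset.sum_congr rfl fun l _ => ?_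
  simp_rw [MvPolynomial.smul_eq_C_mul]
  rw [Finset.prod_mul_distrib, Finset.prod_const, Finset.card_erase_of_mem (Finset.mem_univ l), Finset.card_fin,
    map_mul, map_pow]
  ring

end Scalars

section Wilson

variable (R : Type*) [CommRing R] (p : ℕ) [Fact p.Prime] [CharP R p]

/-- In prime characteristic `p`, `(p−1)! = −1` in `R` (Wilson's theorem transported along `ZMod p → R`) (derived here).
[cite: Matsumura1987, §27 (pp. 207–209)] -/
theorem cast_factorial_pred_eq_neg_one : ((p - 1)! : R) = -1 := by
  have h := congrArg (ZMod.castHom (dvd_refl p) R) (ZMod.wilsons_lemma (p := p))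
  rwa [map_natCast, map_neg, map_one] at h

/-- In prime characteristic `p`, `(p−1)!` is invertible (inverse `−1`), so `factorialInvSeq p` is available and
`factorial_mul_factorialInvSeq` discharges the hypothesis `∀ k < p, k! · u k = 1` of (S2)/(S3) canonically (derived here).
[cite: Matsumura1987, §27 (pp. 207–209)] -/
@[reducible] noncomputable def invertibleFactorialPred : Invertible ((p - 1)! : R) where
  invOf := -1
  invOf_mul_self := by rw [cast_factorial_pred_eq_neg_one R p]; ring
  mul_invOf_self := by rw [cast_factorial_pred_eq_neg_one R p]; ring

end Wilson

end Literature.AlgebraicGeometry.Resolution.WeightedBlowup
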